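import Literature.Probability.LatticeModels.DoubleCurrents
import Literature.Probability.LatticeModels.PlusCurrents
import Literature.Probability.LatticeModels.CurrentSwitching
import Literature.Probability.LatticeModels.CurrentInsertion
import Literature.Probability.LatticeModels.TorusZeroMode
import Literature.Probability.LatticeModels.IsingTransport
import HarnessLib

/-!
# ADS15 eq. (3.10): the finite-volume random-current bound — proofs

Trunk G02 (T-STATMECH), topic `Probability/LatticeModels`. Sibling proof file of
`DoubleCurrents.lean`: it **discharges the named fact `Literature.Probability.LatticeModels.ads_gammaBound`** — eq. (3.10)
of

* M. Aizenman, H. Duminil-Copin, V. Sidoravicius, *Random currents and continuity of Ising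
  model's spontaneous magnetization*, Comm. Math. Phys. **334** (2015) 719–742, §3.2
  (arXiv:1311.1937v3 numbering; bib key `AizenmanDuminilCopinSidoraviciusCMP2015`, "ADS15"):

  `⟨σ_xσ_y⟩⁺_{Λ_L,β} - ⟨σ_xσ_y⟩⁰_{Λ_L,β} ≤ Γ_{x,y}⁻¹ P⁰_{Λ_L,β} ⊗ P⁺_{Λ_L,β}[x ↔ δ]`,
  nearest-neighbour model on `ℤ^d`, `Γ_{x,y} = tanh(β/2)^{‖x-y‖₁}`,

exactly along the printed argument, every step of which is now a theorem of the tree: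

1. the random-current representations `⟨σ_xσ_y⟩⁰_{Λ_L} = Z⁰(xy)/Z⁰(∅)`, `⟨σ_xσ_y⟩⁺_{Λ_L} = Z⁺(xy)/Z⁺(∅)`
   ((2.7)–(2.8); `PlusCurrents.lean`, transported to the box graphs `freeBoxGraph ≤ plusBoxGraph`
   on `↥Λ_{L+1}` of `DoubleCurrents.lean` by `IsingTransport.lean` / `TorusZeroMode.lean`);
2. the switching lemma (Lemma 2.2; `CurrentSwitching.lean`) giving (3.6),
   `Z⁰(∅)Z⁺(xy) - Z⁰(xy)Z⁺(∅) = ∑_{∂n₁=∅, ∂n₂∩Λ={x,y}} w w (1 - 𝟙[x ↔ y in Λ])`;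
3. the parity argument (3.7), `1 - 𝟙[x ↔ y in Λ] ≤ 𝟙[x ↔ δ]`
   (`Current.exists_reachable_notMem_of_not_connIn`);
4. the insertion map (3.8)–(3.9) along a shortest lattice path from `x` to `y` inside `Λ_L`
   (`CurrentInsertion.lean`), at cost `Γ_{x,y}⁻¹ = tanh(β/2)^{-‖x-y‖₁}`;
5. the identification of `∑_{∂n₁=∅, ∂n₂∩Λ=∅} w w 𝟙[x ↔ δ] / (Z⁰(∅)Z⁺(∅))` with
   `ℙ_{Λ_L,β}[x ↔ δ] = (adsDoubleCurrentLaw d L β).real (exitConn d L x)`.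

Consequences recorded at the end: the random-current heart `plusPair_eq_freePair_of_lroTildeSq`
now follows from the single deep fact `ads_exitProb_tendsto_zero_of_lroTildeSq` (ADS15 Thm. 3.1
with Thms. 2.3/2.5), and so does `m*(β_c) = 0` (`d ≥ 3`) given the classical inputs
`exists_plusMeasure`, `infraredBound`, `criticalBeta_pos`.

## Mathlib status

No random currents in Mathlib. Anchors: `Measure.sum_apply_of_countable`, `Measure.dirac_apply`,
`ENNReal.tsum_toReal_eq`, `tsum_mul_tsum_of_summable_norm`, `Summable.tsum_prod`,
`Function.Injective.tsum_eq`, `SimpleGraph.Reachable.map`, `SimpleGraph.Walk`.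
-/

noncomputable section

open MeasureTheory Filter Topology Finset Literature.Probability.LatticeModels Literature.Probability.Percolation
open scoped symmDiff

namespace Literature.Probability.LatticeModels

variable (d : ℕ)

/-! ### The box `Λ_L` inside `↥Λ_{L+1}` -/

/-- The box `Λ_L` as a finite set of vertices of `↥Λ_{L+1}` (the volume of the free and the plus
systems carried by `freeBoxGraph` / `plusBoxGraph`). [cite: AizenmanDuminilCopinSidoraviciusCMP2015, §2.1] -/
def boxCore (L : ℕ) : Finset (BoxVertex d L) := univ.filter fun v => (v : Site d) ∈ box d L

/-- Membership in `boxCore`. [folklore] -/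
@[simp] theorem mem_boxCore {L : ℕ} {v : BoxVertex d L} :
    v ∈ boxCore d L ↔ (v : Site d) ∈ box d L := by
  simp [boxCore]

/-- The inclusion `↥Λ_{L+1} ↪ ℤ^d`. [folklore] -/
def boxEmb (L : ℕ) : BoxVertex d L ↪ Site d := Function.Embedding.subtype _

/-- The inclusion is the coercion. [folklore] -/
@[simp] theorem boxEmb_apply {L : ℕ} (v : BoxVertex d L) : boxEmb d L v = (v : Site d) := rfl

/-- `Λ_L ⊆ Λ_{L+1}`. [folklore] -/
theorem box_subset_box_succ (L : ℕ) : box d L ⊆ box d (L + 1) := box_mono d (Nat.le_succ L)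

/-- The image of `boxCore` in `ℤ^d` is the box `Λ_L`. [folklore] -/
theorem map_boxCore (L : ℕ) : (boxCore d L).map (boxEmb d L) = box d L := by
  ext x
  simp only [Finset.mem_map, mem_boxCore, boxEmb_apply]
  constructor
  · rintro ⟨v, hv, rfl⟩; exact hv
  · intro hx; exact ⟨⟨x, box_subset_box_succ d L hx⟩, hx, rfl⟩

/-- Neighbours of `Λ_L` lie in `Λ_{L+1}`. [folklore] -/
theorem mem_box_succ_of_zdGraph_adj {L : ℕ} {x y : Site d} (hx : x ∈ box d L)
    (hxy : (zdGraph d).Adj x y) : y ∈ box d (L + 1) := by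
  rw [zdGraph_adj_iff] at hxy
  obtain ⟨i, h | h⟩ := hxy
  · rw [h]; exact Literature.Probability.LatticeModels.add_single_mem_box_succ hx i
  · have : y = x - Pi.single i 1 := by rw [h, add_sub_cancel_right]
    rw [this]; exact Literature.Probability.LatticeModels.sub_single_mem_box_succ hx i

/-- Every edge of the plus box graph touches `Λ_L`: `ℰ^b_{Λ_L} = E(plusBoxGraph)`. [cite: AizenmanDuminilCopinSidoraviciusCMP2015, §2.1, eq. (2.8)] -/
theorem edgesTouching_plusBoxGraph (L : ℕ) :
    edgesTouching (plusBoxGraph d L) (boxCore d L) = (plusBoxGraph d L).edgeFinset := by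
  ext e
  rw [mem_edgesTouching_iff, SimpleGraph.mem_edgeFinset]
  constructor
  · exact fun h => h.1
  · intro he
    refine ⟨he, ?_⟩
    induction e using Sym2.ind with
    | _ a b =>
      have hab := (SimpleGraph.mem_edgeSet _).1 he
      rcases hab.2 with ha | hb
      · exact ⟨a, (mem_boxCore d).2 ha, Sym2.mem_mk_left a b⟩
      · exact ⟨b, (mem_boxCore d).2 hb, Sym2.mem_mk_right a b⟩

/-- Every edge of the free box graph touches (indeed lies in) `Λ_L`. [cite: AizenmanDuminilCopinSidoraviciusCMP2015, §2.1, eq. (2.7)] -/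
theorem edgesTouching_freeBoxGraph (L : ℕ) :
    edgesTouching (freeBoxGraph d L) (boxCore d L) = (freeBoxGraph d L).edgeFinset := by
  ext e
  rw [mem_edgesTouching_iff, SimpleGraph.mem_edgeFinset]
  constructor
  · exact fun h => h.1
  · intro he
    refine ⟨he, ?_⟩
    induction e using Sym2.ind with
    | _ a b =>
      have hab := (SimpleGraph.mem_edgeSet _).1 he
      exact ⟨a, (mem_boxCore d).2 hab.2.1, Sym2.mem_mk_left a b⟩

/-- No edge of the free box graph leaves `Λ_L`: `ℰ_{Λ_L} = ℰ^b_{Λ_L}` for `freeBoxGraph`. [cite: AizenmanDuminilCopinSidoraviciusCMP2015, §2.1, eq. (2.7)] -/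
theorem edgesIn_freeBoxGraph (L : ℕ) :
    edgesIn (freeBoxGraph d L) (boxCore d L) = edgesTouching (freeBoxGraph d L) (boxCore d L) := by
  refine Finset.Subset.antisymm (edgesIn_subset_edgesTouching _) fun e he => ?_
  rw [mem_edgesTouching_iff] at he
  rw [mem_edgesIn_iff]
  refine ⟨he.1, ?_⟩
  have he1 := he.1
  induction e using Sym2.ind with
  | _ a b =>
    have hab := (SimpleGraph.mem_edgeSet _).1 he1
    intro v hv
    rcases Sym2.mem_iff.1 hv with rfl | rfl
    · exact (mem_boxCore d).2 hab.2.1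
    · exact (mem_boxCore d).2 hab.2.2

/-! ### The random-current representations in the box -/

/-- **`⟨σ_A⟩⁺_{Λ_L;β,0} = Z⁺(A)/Z⁺(∅)`** for the nearest-neighbour model: the `+` correlations of
the box `Λ_L ⊂ ℤ^d` are those of the plus box graph (transport along `↥Λ_{L+1} ↪ ℤ^d`,
`isingCorr_plus_map`), to which the `+` random-current representation applies (ADS15 (2.8)). [cite: AizenmanDuminilCopinSidoraviciusCMP2015, §2.1, eq. (2.8)] -/
theorem isingCorr_plus_box_eq (L : ℕ) (β : ℝ) {A : Finset (BoxVertex d L)} (hA : A ⊆ boxCore d L) :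
    isingCorr (zdGraph d) (box d L) β 0 .plus (A.map (boxEmb d L)) =
      plusCurrentSum (plusBoxGraph d L) (boxCore d L) β A /
        plusCurrentSum (plusBoxGraph d L) (boxCore d L) β ∅ := by
  have hadj : ∀ x ∈ boxCore d L, ∀ y : BoxVertex d L,
      ((zdGraph d).Adj (boxEmb d L x) (boxEmb d L y) ↔ (plusBoxGraph d L).Adj x y) := by
    intro x hx y
    rw [plusBoxGraph_adj, boxEmb_apply, boxEmb_apply]
    exact ⟨fun h => ⟨h, Or.inl ((mem_boxCore d).1 hx)⟩, fun h => h.1⟩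
  have hnb : ∀ x ∈ boxCore d L, ∀ y' : Site d, (zdGraph d).Adj (boxEmb d L x) y' →
      ∃ y : BoxVertex d L, boxEmb d L y = y' := by
    intro x hx y' hxy
    exact ⟨⟨y', mem_box_succ_of_zdGraph_adj d ((mem_boxCore d).1 hx) hxy⟩, rfl⟩
  rw [← map_boxCore d L, isingCorr_plus_map (boxEmb d L) hadj hnb β 0 A]
  exact isingCorr_plus_eq_plusCurrentSum_div _ (edgesTouching_plusBoxGraph d L) β hA

/-- **`⟨σ_A⟩⁰_{Λ_L;β,0} = Z⁰(A)/Z⁰(∅)`** for the nearest-neighbour model: the free correlations of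
the box are those of the free box graph (`isingCorr_free_map`), whose free measure in `boxCore`
equals its `+` measure (no edge leaves `boxCore`), to which the representation applies
(ADS15 (2.7)). [cite: AizenmanDuminilCopinSidoraviciusCMP2015, §2.1, eq. (2.7)] -/
theorem isingCorr_free_box_eq (L : ℕ) (β : ℝ) {A : Finset (BoxVertex d L)} (hA : A ⊆ boxCore d L) :
    isingCorr (zdGraph d) (box d L) β 0 .free (A.map (boxEmb d L)) =
      plusCurrentSum (freeBoxGraph d L) (boxCore d L) β A /
        plusCurrentSum (freeBoxGraph d L) (boxCore d L) β ∅ := by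
  have hadj : ∀ x ∈ boxCore d L, ∀ y ∈ boxCore d L,
      ((zdGraph d).Adj (boxEmb d L x) (boxEmb d L y) ↔ (freeBoxGraph d L).Adj x y) := by
    intro x hx y hy
    rw [freeBoxGraph_adj, boxEmb_apply, boxEmb_apply]
    exact ⟨fun h => ⟨h, (mem_boxCore d).1 hx, (mem_boxCore d).1 hy⟩, fun h => h.1⟩
  rw [← map_boxCore d L, isingCorr_free_map (boxEmb d L) hadj β 0 A, isingCorr,
    isingExpect_free_eq_plus_of_edgesIn_eq _ (edgesIn_freeBoxGraph d L)]
  exact isingCorr_plus_eq_plusCurrentSum_div _ (edgesTouching_freeBoxGraph d L) β hA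

/-- Free currents have their sources inside `Λ_L` (the other vertices of `↥Λ_{L+1}` are isolated
in `freeBoxGraph`). [folklore] -/
theorem sources_subset_boxCore {L : ℕ} (n : Current (freeBoxGraph d L)) : n.sources ⊆ boxCore d L := by
  intro x hx
  rw [Current.mem_sources_iff] at hx
  by_contra hxc
  have h0 : n.degree x = 0 := by
    unfold Current.degree
    refine Finset.sum_eq_zero fun e _ => ?_
    rw [if_neg]
    intro hxe
    obtain ⟨e, he⟩ := e
    induction e using Sym2.ind with
    | _ a b =>
      have hab := (SimpleGraph.mem_edgeSet _).1 (SimpleGraph.mem_edgeFinset.1 he)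
      rcases Sym2.mem_iff.1 hxe with rfl | rfl
      · exact hxc ((mem_boxCore d).2 hab.2.1)
      · exact hxc ((mem_boxCore d).2 hab.2.2)
  rw [h0] at hx
  exact (Nat.not_odd_iff_even.2 (Even.zero)) hx

/-- The source constraint of the plus current: "no sources in `Λ_L`" is `∂n ∩ boxCore = ∅`. [folklore] -/
theorem forall_sources_notMem_iff {L : ℕ} (n : Current (plusBoxGraph d L)) :
    (∀ v ∈ n.sources, (v : Site d) ∉ box d L) ↔ n.sources ∩ boxCore d L = ∅ := by
  rw [Finset.eq_empty_iff_forall_notMem]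
  simp only [Finset.mem_inter, mem_boxCore, not_and]

/-- **The free generating sums as sums over supported currents of the plus box graph**:
`Z⁰(A) = ∑_{n ⊆ E(freeBoxGraph), ∂n = A} w_β(n)` (extension by zero, `Current.tsum_extend_eq`). [folklore] -/
theorem plusCurrentSum_free_eq_tsum (L : ℕ) (β : ℝ) (A : Finset (BoxVertex d L)) :
    plusCurrentSum (freeBoxGraph d L) (boxCore d L) β A =
      ∑' n : Current (plusBoxGraph d L),
        if Current.IsSupp (freeBoxGraph d L) n ∧ n.sources = A then n.weight β else 0 := by
  have hle := freeBoxGraph_le_plusBoxGraph d L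
  unfold plusCurrentSum
  have h1 : ∀ n : Current (freeBoxGraph d L), n.sources ∩ boxCore d L = n.sources := fun n =>
    Finset.inter_eq_left.2 (sources_subset_boxCore d n)
  simp_rw [h1, ite_and]
  rw [← Current.tsum_extend_eq hle (fun n => if n.sources = A then n.weight β else 0)]
  refine tsum_congr fun n => ?_
  simp only [Current.sources_extend hle, Current.weight_extend hle]

/-! ### A shortest lattice path inside the box -/

/-- **A monotone lattice path**: two vertices of `Λ_L` are joined in the plus box graph by a walk
of length `‖x - y‖₁` (move one coordinate at a time towards `y`; all intermediate points stay in
the box) — the path `x = x_0, …, x_m = y` of ADS15 (3.8). [cite: AizenmanDuminilCopinSidoraviciusCMP2015, §3.2, eq. (3.8)] -/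
theorem exists_walk_length_eq_l1Dist {L : ℕ} (x y : BoxVertex d L)
    (hx : (x : Site d) ∈ box d L) (hy : (y : Site d) ∈ box d L) :
    ∃ p : (plusBoxGraph d L).Walk x y, p.length = l1Dist d x y := by
  suffices key : ∀ (n : ℕ) (x : BoxVertex d L), (x : Site d) ∈ box d L → l1Dist d x y = n →
      ∃ p : (plusBoxGraph d L).Walk x y, p.length = n by
    exact key _ x hx rfl
  intro n
  induction n with
  | zero =>
    intro x hx h0
    have hxy : x = y := by
      apply Subtype.ext
      funext i
      have := Finset.sum_eq_zero_iff.1 h0 i (Finset.mem_univ i)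
      omega
    subst hxy
    exact ⟨SimpleGraph.Walk.nil, rfl⟩
  | succ n ih =>
    intro x hx hn
    -- a coordinate where `x` and `y` differ
    have hex : ∃ i, (x : Site d) i ≠ (y : Site d) i := by
      by_contra hcon
      have : l1Dist d x y = 0 := Finset.sum_eq_zero fun i _ => by
        have : (x : Site d) i = (y : Site d) i := by_contra fun h => hcon ⟨i, h⟩
        rw [this, sub_self]; rfl
      omega
    obtain ⟨i, hi⟩ := hex
    have hxb := (mem_box.1 hx) i
    have hyb := (mem_box.1 hy) i
    -- the step towards `y`
    set s : ℤ := if (x : Site d) i < (y : Site d) i then 1 else -1 with hs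
    set x₁ : Site d := (x : Site d) + Pi.single i s with hx₁
    have hx₁i : x₁ i = (x : Site d) i + s := by simp [hx₁]
    have hx₁j : ∀ j, j ≠ i → x₁ j = (x : Site d) j := fun j hj => by simp [hx₁, Pi.single_eq_of_ne hj]
    have hx₁box : x₁ ∈ box d L := by
      rw [mem_box]
      intro j
      by_cases hj : j = i
      · subst hj
        rw [hx₁i, hs]
        split_ifs with hlt <;> constructor <;> omega
      · rw [hx₁j j hj]; exact (mem_box.1 hx) j
    have hadj : (zdGraph d).Adj (x : Site d) x₁ := by
      rw [zdGraph_adj_iff]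
      refine ⟨i, ?_⟩
      by_cases hlt : (x : Site d) i < (y : Site d) i
      · left; rw [hx₁, hs, if_pos hlt]
      · right
        rw [hx₁, hs, if_neg hlt, add_assoc, ← Pi.single_add]
        simp
    have hdist : l1Dist d x₁ y = n := by
      have h1 : l1Dist d x y = ((x : Site d) i - (y : Site d) i).natAbs +
          ∑ j ∈ univ.erase i, ((x : Site d) j - (y : Site d) j).natAbs :=
        (Finset.add_sum_erase _ _ (Finset.mem_univ i)).symm
      have h2 : l1Dist d x₁ y = (x₁ i - (y : Site d) i).natAbs +
          ∑ j ∈ univ.erase i, (x₁ j - (y : Site d) j).natAbs :=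
        (Finset.add_sum_erase _ _ (Finset.mem_univ i)).symm
      have h3 : ∑ j ∈ univ.erase i, (x₁ j - (y : Site d) j).natAbs =
          ∑ j ∈ univ.erase i, ((x : Site d) j - (y : Site d) j).natAbs :=
        Finset.sum_congr rfl fun j hj => by rw [hx₁j j (Finset.ne_of_mem_erase hj)]
      have h4 : (x₁ i - (y : Site d) i).natAbs + 1 = ((x : Site d) i - (y : Site d) i).natAbs := by
        rw [hx₁i, hs]
        split_ifs with hlt <;> omega
      omega
    set x₁' : BoxVertex d L := ⟨x₁, box_subset_box_succ d L hx₁box⟩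
    obtain ⟨q, hq⟩ := ih x₁' hx₁box hdist
    have hadj' : (plusBoxGraph d L).Adj x x₁' := ⟨hadj, Or.inl hx⟩
    exact ⟨SimpleGraph.Walk.cons hadj' q, by rw [SimpleGraph.Walk.length_cons, hq]⟩

/-! ### Lifting connections to `ℤ^d` -/

/-- `liftBonds` is monotone. [folklore] -/
theorem liftBonds_mono {L : ℕ} {ω ω' : BondConfig (BoxVertex d L)} (h : ω ⊆ ω') :
    liftBonds d L ω ⊆ liftBonds d L ω' :=
  Set.image_mono h

/-- Open paths in `↥Λ_{L+1}` are open paths in `ℤ^d` after lifting the bonds. [folklore] -/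
theorem reachable_liftBonds {L : ℕ} {ω : BondConfig (BoxVertex d L)} {a b : BoxVertex d L}
    (h : (openGraph ω).Reachable a b) : (openGraph (liftBonds d L ω)).Reachable (a : Site d) b := by
  let f : openGraph ω →g openGraph (liftBonds d L ω) :=
    { toFun := fun v => (v : Site d)
      map_rel' := by
        intro u v huv
        rw [openGraph_adj] at huv ⊢
        exact ⟨⟨s(u, v), huv.1, by simp⟩, fun h => huv.2 (Subtype.ext h)⟩ }
  exact h.map f

/-- A connection from `x` to a vertex outside `Λ_L` is the exit event `x ↔ δ` after lifting. [cite: AizenmanDuminilCopinSidoraviciusCMP2015, §3.2, eq. (3.7)] -/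
theorem liftBonds_mem_exitConn {L : ℕ} {ω : BondConfig (BoxVertex d L)} {x v : BoxVertex d L}
    (hv : (v : Site d) ∉ box d L) (h : (openGraph ω).Reachable x v) :
    liftBonds d L ω ∈ exitConn d L (x : Site d) :=
  ⟨v, hv, reachable_liftBonds d h⟩

/-! ### The double-current law evaluated on an event -/

/-- For `β ≥ 0` the pair weights are dominated by the product of the weights. [folklore] -/
theorem abs_adsPairWeight_le (L : ℕ) {β : ℝ} (hβ : 0 ≤ β)
    (p : Current (freeBoxGraph d L) × Current (plusBoxGraph d L)) :
    |adsPairWeight d L β p| ≤ p.1.weight β * p.2.weight β := by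
  rw [abs_of_nonneg (adsPairWeight_nonneg d L hβ p)]
  unfold adsPairWeight
  split_ifs
  · exact le_rfl
  · exact mul_nonneg (Current.weight_nonneg hβ _) (Current.weight_nonneg hβ _)

/-- The pair weights are summable (`β ≥ 0`). [cite: AizenmanDuminilCopinSidoraviciusCMP2015, §3.1, eq. (3.1)] -/
theorem summable_adsPairWeight_mul (L : ℕ) {β : ℝ} (hβ : 0 ≤ β)
    (g : Current (freeBoxGraph d L) × Current (plusBoxGraph d L) → ℝ) (hg : ∀ p, |g p| ≤ 1) :
    Summable fun p => adsPairWeight d L β p * g p := by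
  have h := (summable_currentWeight_holds (freeBoxGraph d L) β).mul_of_nonneg
    (summable_currentWeight_holds (plusBoxGraph d L) β) (fun n => Current.weight_nonneg hβ n)
    (fun n => Current.weight_nonneg hβ n)
  refine h.of_norm_bounded fun p => ?_
  rw [Real.norm_eq_abs, abs_mul]
  calc |adsPairWeight d L β p| * |g p| ≤ p.1.weight β * p.2.weight β * 1 :=
        mul_le_mul (abs_adsPairWeight_le d L hβ p) (hg p) (abs_nonneg _)
          (mul_nonneg (Current.weight_nonneg hβ _) (Current.weight_nonneg hβ _))
    _ = p.1.weight β * p.2.weight β := mul_one _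

open Classical in
/-- **The double current evaluated on an event**: for `β ≥ 0` and `adsPairNorm > 0`,
`ℙ_{Λ_L,β}(s) = ∑_{(n₁,n₂)} w(n₁,n₂)/Z · 𝟙[n̂₁ ∪ n̂₂ ∈ s]` (a countable sum of Dirac masses). [cite: AizenmanDuminilCopinSidoraviciusCMP2015, §3.1, eq. (3.1)] -/
theorem adsDoubleCurrentLaw_real_apply (L : ℕ) {β : ℝ} (hβ : 0 ≤ β) (hN : 0 < adsPairNorm d L β)
    (s : Set (BondConfig (Site d))) :
    (adsDoubleCurrentLaw d L β).real s =
      ∑' p : Current (freeBoxGraph d L) × Current (plusBoxGraph d L),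
        adsPairWeight d L β p / adsPairNorm d L β *
          (if liftBonds d L (p.1.traced ∪ p.2.traced) ∈ s then 1 else 0) := by
  classical
  rw [measureReal_def, adsDoubleCurrentLaw, Measure.sum_apply_of_countable]
  simp only [Measure.smul_apply, smul_eq_mul, Measure.dirac_apply]
  rw [ENNReal.tsum_toReal_eq]
  · refine tsum_congr fun p => ?_
    have hnn : 0 ≤ adsPairWeight d L β p / adsPairNorm d L β :=
      div_nonneg (adsPairWeight_nonneg d L hβ p) hN.le
    by_cases hp : liftBonds d L (p.1.traced ∪ p.2.traced) ∈ s
    · rw [Set.indicator_of_mem hp, if_pos hp, Pi.one_apply, mul_one, mul_one,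
        ENNReal.toReal_ofReal hnn]
    · rw [Set.indicator_of_notMem hp, if_neg hp, mul_zero, mul_zero, ENNReal.toReal_zero]
  · intro p
    exact ENNReal.mul_ne_top ENNReal.ofReal_ne_top
      (ne_top_of_le_ne_top ENNReal.one_ne_top (Set.indicator_le_self' (fun _ _ => zero_le_one) _))

/-! ### The normaliser and the total mass of the double current -/

/-- **The normaliser factorises**: `adsPairNorm = Z⁰_{Λ_L}(∅) · Z⁺_{Λ_L}(∅)`, the product of the
free and the plus sourceless generating sums (ADS15 (3.1), denominator
`∑_{∂n₁=∅} w(n₁) ∑_{∂n₂=∅} w(n₂)`), for `β ≥ 0`. [cite: AizenmanDuminilCopinSidoraviciusCMP2015, §3.1, eq. (3.1)] -/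
theorem adsPairNorm_eq_mul (L : ℕ) {β : ℝ} (hβ : 0 ≤ β) :
    adsPairNorm d L β =
      plusCurrentSum (freeBoxGraph d L) (boxCore d L) β ∅ *
        plusCurrentSum (plusBoxGraph d L) (boxCore d L) β ∅ := by
  set f : Current (freeBoxGraph d L) → ℝ := fun n => if n.sources ∩ boxCore d L = ∅ then n.weight β else 0
    with hf
  set g : Current (plusBoxGraph d L) → ℝ := fun n => if n.sources ∩ boxCore d L = ∅ then n.weight β else 0
    with hg
  have hfs : Summable fun n => ‖f n‖ := by
    refine Summable.of_nonneg_of_le (fun n => norm_nonneg _) (fun n => ?_)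
      (summable_currentWeight_holds (freeBoxGraph d L) β)
    rw [Real.norm_eq_abs]
    simp only [hf]
    split_ifs
    · rw [abs_of_nonneg (Current.weight_nonneg hβ n)]
    · rw [abs_zero]; exact Current.weight_nonneg hβ n
  have hgs : Summable fun n => ‖g n‖ := by
    refine Summable.of_nonneg_of_le (fun n => norm_nonneg _) (fun n => ?_)
      (summable_currentWeight_holds (plusBoxGraph d L) β)
    rw [Real.norm_eq_abs]
    simp only [hg]
    split_ifs
    · rw [abs_of_nonneg (Current.weight_nonneg hβ n)]
    · rw [abs_zero]; exact Current.weight_nonneg hβ n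
  have hw : ∀ p, adsPairWeight d L β p = f p.1 * g p.2 := by
    intro p
    simp only [hf, hg, adsPairWeight, Finset.inter_eq_left.2 (sources_subset_boxCore d p.1),
      ← forall_sources_notMem_iff d p.2]
    by_cases h1 : p.1.sources = ∅
    · by_cases h2 : ∀ v ∈ p.2.sources, (v : Site d) ∉ box d L
      · rw [if_pos ⟨h1, h2⟩, if_pos h1, if_pos h2]
      · have h12 : ¬(p.1.sources = ∅ ∧ ∀ v ∈ p.2.sources, (v : Site d) ∉ box d L) := fun h => h2 h.2
        rw [if_neg h12, if_neg h2, mul_zero]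
    · have h12 : ¬(p.1.sources = ∅ ∧ ∀ v ∈ p.2.sources, (v : Site d) ∉ box d L) := fun h => h1 h.1
      rw [if_neg h12, if_neg h1, zero_mul]
  unfold adsPairNorm plusCurrentSum
  simp_rw [hw]
  exact (tsum_mul_tsum_of_summable_norm hfs hgs).symm

/-- **The normaliser is positive** (`β ≥ 0`): both factors contain the zero current. [cite: AizenmanDuminilCopinSidoraviciusCMP2015, §3.1, eq. (3.1)] -/
theorem adsPairNorm_pos (L : ℕ) {β : ℝ} (hβ : 0 ≤ β) : 0 < adsPairNorm d L β := by
  rw [adsPairNorm_eq_mul d L hβ]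
  exact mul_pos (plusCurrentSum_empty_pos _ (edgesTouching_freeBoxGraph d L) β)
    (plusCurrentSum_empty_pos _ (edgesTouching_plusBoxGraph d L) β)

/-- The pair weights sum to the normaliser (`β ≥ 0`). [cite: AizenmanDuminilCopinSidoraviciusCMP2015, §3.1, eq. (3.1)] -/
theorem hasSum_adsPairWeight (L : ℕ) {β : ℝ} (hβ : 0 ≤ β) :
    HasSum (adsPairWeight d L β) (adsPairNorm d L β) := by
  have h := summable_adsPairWeight_mul d L hβ (fun _ => 1) (fun _ => by norm_num)
  simp only [mul_one] at h
  exact h.hasSum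

/-- **The double random current of the box is a probability measure** for `β ≥ 0`
(total mass `∑ w/Z = Z/Z = 1`; this removes the "normaliser might vanish / summability not
proved" caveat in the docstring of `adsDoubleCurrentLaw`). [cite: AizenmanDuminilCopinSidoraviciusCMP2015, §2.3 and §3.1, eq. (3.1)] -/
theorem isProbabilityMeasure_adsDoubleCurrentLaw (L : ℕ) {β : ℝ} (hβ : 0 ≤ β) :
    IsProbabilityMeasure (adsDoubleCurrentLaw d L β) := by
  constructor
  rw [adsDoubleCurrentLaw, Measure.sum_apply_of_countable]
  simp only [Measure.smul_apply, Measure.dirac_apply_of_mem (Set.mem_univ _), smul_eq_mul, mul_one]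
  have hN := adsPairNorm_pos d L hβ
  have hnonneg : ∀ p, 0 ≤ adsPairWeight d L β p / adsPairNorm d L β := fun p =>
    div_nonneg (adsPairWeight_nonneg d L hβ p) hN.le
  have hsum : HasSum (fun p => adsPairWeight d L β p / adsPairNorm d L β) 1 := by
    have h := (hasSum_adsPairWeight d L hβ).div_const (adsPairNorm d L β)
    rwa [div_self hN.ne'] at h
  rw [← ENNReal.ofReal_one, ← hsum.tsum_eq, ENNReal.ofReal_tsum_of_nonneg hnonneg hsum.summable]

/-! ### Pair sums as sums over pairs of currents of the plus box graph -/

/-- **Reindexing the double current by supported currents**: a sum over pairs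
(free current `n₁`, plus current `n₂`) weighted by `adsPairWeight` is the sum over pairs of currents
of the plus box graph whose first member is supported on the free box graph, with the weights
`𝟙[n₁ ⊆ E(freeBoxGraph), ∂n₁ = ∅] w(n₁) · 𝟙[∂n₂ ∩ Λ_L = ∅] w(n₂)` of `CurrentSwitching.lean`
(extension by zero `Current.extend` is injective and preserves weights and sources). No
summability is needed. [folklore] -/
theorem tsum_adsPairWeight_mul_eq (L : ℕ) (β : ℝ)
    (g : Current (plusBoxGraph d L) × Current (plusBoxGraph d L) → ℝ) :
    ∑' q : Current (freeBoxGraph d L) × Current (plusBoxGraph d L),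
        adsPairWeight d L β q * g (Current.extend q.1, q.2) =
      ∑' p : Current (plusBoxGraph d L) × Current (plusBoxGraph d L),
        (if Current.IsSupp (freeBoxGraph d L) p.1 ∧ p.1.sources = ∅ then p.1.weight β else 0) *
          ((if p.2.sources ∩ boxCore d L = ∅ then p.2.weight β else 0) * g p) := by
  classical
  have hle := freeBoxGraph_le_plusBoxGraph d L
  set J : Current (freeBoxGraph d L) × Current (plusBoxGraph d L) →
      Current (plusBoxGraph d L) × Current (plusBoxGraph d L) := fun q => (Current.extend q.1, q.2)
    with hJ
  have hJinj : Function.Injective J := by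
    rintro ⟨q1, q2⟩ ⟨r1, r2⟩ h
    simp only [hJ, Prod.mk.injEq] at h
    exact Prod.ext (Current.extend_injective hle h.1) h.2
  have hsupp : Function.support (fun p : Current (plusBoxGraph d L) × Current (plusBoxGraph d L) =>
      (if Current.IsSupp (freeBoxGraph d L) p.1 ∧ p.1.sources = ∅ then p.1.weight β else 0) *
        ((if p.2.sources ∩ boxCore d L = ∅ then p.2.weight β else 0) * g p)) ⊆ Set.range J := by
    intro p hp
    rw [Function.mem_support] at hp
    have hap := left_ne_zero_of_mul hp
    have hsp : Current.IsSupp (freeBoxGraph d L) p.1 := by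
      by_contra h
      have h' : ¬(Current.IsSupp (freeBoxGraph d L) p.1 ∧ p.1.sources = ∅) := fun h' => h h'.1
      exact hap (if_neg h')
    obtain ⟨n₁, hn₁⟩ := Current.exists_extend_eq_of_isSupp hle hsp
    exact ⟨(n₁, p.2), Prod.ext hn₁ rfl⟩
  rw [← hJinj.tsum_eq hsupp]
  refine tsum_congr fun q => ?_
  simp only [hJ]
  rw [Current.sources_extend hle, Current.weight_extend hle, adsPairWeight]
  have hb : (if q.2.sources ∩ boxCore d L = ∅ then q.2.weight β else 0) =
      if ∀ v ∈ q.2.sources, (v : Site d) ∉ box d L then q.2.weight β else 0 := by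
    by_cases h : q.2.sources ∩ boxCore d L = ∅
    · rw [if_pos h, if_pos ((forall_sources_notMem_iff d q.2).2 h)]
    · rw [if_neg h, if_neg fun h' => h ((forall_sources_notMem_iff d q.2).1 h')]
  rw [hb]
  by_cases h1 : q.1.sources = ∅
  · by_cases h2 : ∀ v ∈ q.2.sources, (v : Site d) ∉ box d L
    · rw [if_pos ⟨h1, h2⟩, if_pos ⟨Current.isSupp_extend q.1, h1⟩, if_pos h2]; ring
    · have h12 : ¬(q.1.sources = ∅ ∧ ∀ v ∈ q.2.sources, (v : Site d) ∉ box d L) :=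
        fun h => h2 h.2
      rw [if_neg h12, if_neg h2]; ring
  · have h12 : ¬(q.1.sources = ∅ ∧ ∀ v ∈ q.2.sources, (v : Site d) ∉ box d L) :=
      fun h => h1 h.1
    have h1' : ¬(Current.IsSupp (freeBoxGraph d L) (Current.extend (G := plusBoxGraph d L) q.1) ∧
        q.1.sources = ∅) := fun h => h1 h.2
    rw [if_neg h12, if_neg h1']; ring

end Literature.Probability.LatticeModels

namespace Literature.Probability.LatticeModels

open Percolation

variable {d : ℕ}

/-! ### The discharge of `ads_gammaBound` -/

/-- **ADS15 eq. (3.10), proved** (Aizenman–Duminil-Copin–Sidoravicius, CMP 334 (2015), §3.2,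
arXiv v3 (3.6)–(3.10)): for the nearest-neighbour Ising model on `ℤ^d`, `β > 0`, `x, y ∈ Λ_L`,
`⟨σ_xσ_y⟩⁺_{Λ_L,β} - ⟨σ_xσ_y⟩⁰_{Λ_L,β} ≤ tanh(β/2)^{-‖x-y‖₁} ℙ_{Λ_L,β}[x ↔ δ]`. Discharges the
named fact `ads_gammaBound` of `DoubleCurrents.lean` by the printed argument: random-current
representations (2.7)–(2.8), switching lemma (3.6), parity (3.7), insertion map (3.8)–(3.9). [cite: AizenmanDuminilCopinSidoraviciusCMP2015, §3.2, eq. (3.10)] -/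
theorem ads_gammaBound_holds : ads_gammaBound (d := d) := by
  classical
  intro β hβ L x y hx hy
  -- the degenerate case `x = y`
  by_cases hxy : x = y
  · subst hxy
    rw [isingTwoPoint_self, isingTwoPoint_self, sub_self]
    exact mul_nonneg (inv_nonneg.2 (pow_nonneg (Real.tanh_half_pos hβ).le _)) measureReal_nonneg
  -- notation
  set G := plusBoxGraph d L with hG
  set G₀ := freeBoxGraph d L with hG₀
  set Λ := boxCore d L with hΛ
  have hle : G₀ ≤ G := freeBoxGraph_le_plusBoxGraph d L
  set x' : BoxVertex d L := ⟨x, box_subset_box_succ d L hx⟩ with hx'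
  set y' : BoxVertex d L := ⟨y, box_subset_box_succ d L hy⟩ with hy'
  have hxy' : x' ≠ y' := fun h => hxy (congrArg Subtype.val h)
  have hx'Λ : x' ∈ Λ := (mem_boxCore d).2 hx
  have hy'Λ : y' ∈ Λ := (mem_boxCore d).2 hy
  set D : Finset (BoxVertex d L) := {x'} ∆ {y'} with hD
  have hDpair : D = {x', y'} := Current.symmDiff_singleton_eq_pair hxy'
  have hDΛ : D ⊆ Λ := by
    rw [hDpair]
    intro v hv
    rcases Finset.mem_insert.1 hv with rfl | hv
    · exact hx'Λ
    · rw [Finset.mem_singleton.1 hv]; exact hy'Λ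
  have hDmap : D.map (boxEmb d L) = {x, y} := by
    rw [hDpair, Finset.map_insert, Finset.map_singleton]; rfl
  -- the generating sums
  set Z₀ : Finset (BoxVertex d L) → ℝ := fun A => plusCurrentSum G₀ Λ β A with hZ₀
  set Z : Finset (BoxVertex d L) → ℝ := fun B => plusCurrentSum G Λ β B with hZ
  have hZ₀pos : 0 < Z₀ ∅ := plusCurrentSum_empty_pos G₀ (edgesTouching_freeBoxGraph d L) β
  have hZpos : 0 < Z ∅ := plusCurrentSum_empty_pos G (edgesTouching_plusBoxGraph d L) β
  -- Step 1: the two random-current representations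
  have hplus : isingTwoPoint (zdGraph d) (box d L) β 0 .plus x y = Z D / Z ∅ := by
    rw [isingTwoPoint_eq_isingCorr _ _ _ _ _ hxy, ← hDmap]
    exact isingCorr_plus_box_eq d L β hDΛ
  have hfree : isingTwoPoint (zdGraph d) (box d L) β 0 .free x y = Z₀ D / Z₀ ∅ := by
    rw [isingTwoPoint_eq_isingCorr _ _ _ _ _ hxy, ← hDmap]
    exact isingCorr_free_box_eq d L β hDΛ
  -- the weight families on currents of `G`
  set a : Finset (BoxVertex d L) → Current G → ℝ := fun A n =>
    if Current.IsSupp G₀ n ∧ n.sources = A then n.weight β else 0 with ha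
  set b : Finset (BoxVertex d L) → Current G → ℝ := fun B n =>
    if n.sources ∩ Λ = B then n.weight β else 0 with hb
  have ha0 : ∀ A n, 0 ≤ a A n := fun A n => by
    simp only [ha]; split_ifs
    · exact Current.weight_nonneg hβ.le n
    · exact le_rfl
  have hb0 : ∀ B n, 0 ≤ b B n := fun B n => by
    simp only [hb]; split_ifs
    · exact Current.weight_nonneg hβ.le n
    · exact le_rfl
  have hale : ∀ A n, |a A n| ≤ n.weight β := fun A n => by
    rw [abs_of_nonneg (ha0 A n)]; simp only [ha]; split_ifs
    · exact le_rfl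
    · exact Current.weight_nonneg hβ.le n
  have hble : ∀ B n, |b B n| ≤ n.weight β := fun B n => by
    rw [abs_of_nonneg (hb0 B n)]; simp only [hb]; split_ifs
    · exact le_rfl
    · exact Current.weight_nonneg hβ.le n
  have hw := summable_currentWeight_holds G β
  have has : ∀ A, Summable fun n => ‖a A n‖ := fun A =>
    Summable.of_nonneg_of_le (fun n => norm_nonneg _) (fun n => by rw [Real.norm_eq_abs]; exact hale A n) hw
  have hbs : ∀ B, Summable fun n => ‖b B n‖ := fun B =>
    Summable.of_nonneg_of_le (fun n => norm_nonneg _) (fun n => by rw [Real.norm_eq_abs]; exact hble B n) hw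
  have hZ₀a : ∀ A, Z₀ A = ∑' n, a A n := fun A => plusCurrentSum_free_eq_tsum d L β A
  have hZb : ∀ B, Z B = ∑' n, b B n := fun B => rfl
  -- pair families are summable
  have hww : Summable fun p : Current G × Current G => p.1.weight β * p.2.weight β :=
    hw.mul_of_nonneg hw (fun n => Current.weight_nonneg hβ.le n) (fun n => Current.weight_nonneg hβ.le n)
  have hpair : ∀ (A B) (g : Current G × Current G → ℝ), (∀ p, |g p| ≤ 1) →
      Summable fun p : Current G × Current G => a A p.1 * b B p.2 * g p := by
    intro A B g hg
    refine hww.of_norm_bounded fun p => ?_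
    rw [Real.norm_eq_abs, abs_mul, abs_mul]
    calc |a A p.1| * |b B p.2| * |g p| ≤ p.1.weight β * p.2.weight β * 1 :=
          mul_le_mul (mul_le_mul (hale A p.1) (hble B p.2) (abs_nonneg _)
            (Current.weight_nonneg hβ.le _)) (hg p) (abs_nonneg _)
            (mul_nonneg (Current.weight_nonneg hβ.le _) (Current.weight_nonneg hβ.le _))
      _ = p.1.weight β * p.2.weight β := mul_one _
  have hprod : ∀ A B, Z₀ A * Z B = ∑' p : Current G × Current G, a A p.1 * b B p.2 := by
    intro A B
    rw [hZ₀a, hZb]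
    exact tsum_mul_tsum_of_summable_norm (has A) (hbs B)
  -- Step 2: the switching lemma, (3.6)
  set conn : Current G → ℝ := (Current.connIn G₀ x' y').indicator 1 with hconn
  have hconn01 : ∀ m, conn m = 0 ∨ conn m = 1 := fun m => by
    simp only [hconn, Set.indicator_apply, Pi.one_apply]
    split_ifs <;> simp
  have hconn_le : ∀ m, |conn m| ≤ 1 := fun m => by
    rcases hconn01 m with h | h <;> rw [h] <;> norm_num
  have hsw := Current.tsum_switching (G := G) G₀ β Λ D ∅ x' y' (fun _ => (1 : ℝ))
    ⟨1, fun _ => by norm_num⟩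
  have hDD : D ∆ ({x'} ∆ {y'}) = ∅ := by rw [hD, symmDiff_self]; rfl
  have hD' : (∅ : Finset (BoxVertex d L)) ∆ (({x'} ∆ {y'}) ∩ Λ) = D := by
    rw [← hD, Finset.inter_eq_left.2 hDΛ, ← Finset.bot_eq_empty, bot_symmDiff]
  simp only [one_mul] at hsw
  rw [hDD, hD'] at hsw
  -- on `{∂n₁ = D}` the indicator is `1`
  have hsw_l : ∑' p : Current G × Current G, a D p.1 * b ∅ p.2 * conn (p.1 + p.2) =
      ∑' p : Current G × Current G, a D p.1 * b ∅ p.2 := by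
    refine tsum_congr fun p => ?_
    by_cases hp : Current.IsSupp G₀ p.1 ∧ p.1.sources = D
    · have : conn (p.1 + p.2) = 1 := by
        simp only [hconn, Set.indicator_of_mem (Current.add_mem_connIn_of_sources_eq G₀ hp.1 hp.2 p.2),
          Pi.one_apply]
      rw [this, mul_one]
    · simp only [ha, if_neg hp, zero_mul]
  have h36 : Z₀ D * Z ∅ = ∑' p : Current G × Current G, a ∅ p.1 * b D p.2 * conn (p.1 + p.2) := by
    rw [hprod, ← hsw_l]
    exact hsw
  -- Step 3: the numerator and (3.7)
  set X : Current G → Current G → ℝ := fun n₁ n₂ =>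
    if liftBonds d L (n₁.traced ∪ n₂.traced) ∈ exitConn d L x then 1 else 0 with hX
  have hX0 : ∀ n₁ n₂, 0 ≤ X n₁ n₂ := fun n₁ n₂ => by simp only [hX]; split_ifs <;> norm_num
  have hX1 : ∀ n₁ n₂, X n₁ n₂ ≤ 1 := fun n₁ n₂ => by simp only [hX]; split_ifs <;> norm_num
  have hXle : ∀ n₁ n₂, |X n₁ n₂| ≤ 1 := fun n₁ n₂ => by
    rw [abs_of_nonneg (hX0 n₁ n₂)]; exact hX1 n₁ n₂
  have hXmono : ∀ n₁ n₂ n₂', n₂.traced ⊆ n₂'.traced → X n₁ n₂ ≤ X n₁ n₂' := by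
    intro n₁ n₂ n₂' hsub
    simp only [hX]
    by_cases h2 : liftBonds d L (n₁.traced ∪ n₂.traced) ∈ exitConn d L x
    · rw [if_pos h2, if_pos]
      exact exitConn_mono d (liftBonds_mono d (Set.union_subset_union_right _ hsub)) h2
    · rw [if_neg h2]; split_ifs <;> norm_num
  have hGΛ : ∀ a' b' : BoxVertex d L, a' ∈ Λ → b' ∈ Λ → G.Adj a' b' → G₀.Adj a' b' := by
    intro a' b' ha' hb' hab
    exact ⟨hab.1, (mem_boxCore d).1 ha', (mem_boxCore d).1 hb'⟩
  have h37 : ∀ p : Current G × Current G,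
      a ∅ p.1 * b D p.2 * (1 - conn (p.1 + p.2)) ≤ a ∅ p.1 * (b D p.2 * X p.1 p.2) := by
    intro p
    rw [mul_assoc]
    refine mul_le_mul_of_nonneg_left ?_ (ha0 ∅ p.1)
    by_cases hbD : p.2.sources ∩ Λ = D
    · refine mul_le_mul_of_nonneg_left ?_ (hb0 D p.2)
      rcases hconn01 (p.1 + p.2) with h0 | h1
      · -- not connected inside `Λ`: the cluster of `x` leaves the box, (3.7)
        have hnc : ¬(openGraph ((p.1 + p.2).tracedIn G₀)).Reachable x' y' := by
          intro h
          have : conn (p.1 + p.2) = 1 := by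
            simp only [hconn, Set.indicator_of_mem (show p.1 + p.2 ∈ Current.connIn G₀ x' y' from h),
              Pi.one_apply]
          rw [h0] at this; exact zero_ne_one this
        have hnc2 : ¬(openGraph (p.2.tracedIn G₀)).Reachable x' y' := fun h =>
          hnc (Current.connIn_mono G₀ (le_add_self : p.2 ≤ p.1 + p.2) h)
        obtain ⟨v, hvΛ, hv⟩ :=
          Current.exists_reachable_notMem_of_not_connIn G₀ hxy' hbD hGΛ hnc2
        have hexit : liftBonds d L (p.1.traced ∪ p.2.traced) ∈ exitConn d L x :=
          exitConn_mono d (liftBonds_mono d Set.subset_union_right)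
            (liftBonds_mem_exitConn d (fun h => hvΛ ((mem_boxCore d).2 h)) hv)
        simp only [hX, if_pos hexit, h0, sub_zero, le_refl]
      · rw [h1, sub_self]; exact hX0 _ _
    · simp only [hb, if_neg hbD, zero_mul, le_refl]
  have hN : Z₀ ∅ * Z D - Z₀ D * Z ∅ ≤
      ∑' p : Current G × Current G, a ∅ p.1 * (b D p.2 * X p.1 p.2) := by
    have hs1 : Summable fun p : Current G × Current G => a ∅ p.1 * b D p.2 :=
      by simpa using hpair ∅ D (fun _ => 1) (fun _ => by norm_num)
    have hs2 : Summable fun p : Current G × Current G => a ∅ p.1 * b D p.2 * conn (p.1 + p.2) :=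
      hpair ∅ D (fun p => conn (p.1 + p.2)) (fun p => hconn_le _)
    have hs3 : Summable fun p : Current G × Current G => a ∅ p.1 * (b D p.2 * X p.1 p.2) := by
      have := hpair ∅ D (fun p => X p.1 p.2) (fun p => hXle _ _)
      simpa only [mul_assoc] using this
    rw [hprod, h36, ← hs1.tsum_sub hs2]
    refine Summable.tsum_le_tsum (fun p => ?_) (hs1.sub hs2) hs3
    have : a ∅ p.1 * b D p.2 - a ∅ p.1 * b D p.2 * conn (p.1 + p.2) =
        a ∅ p.1 * b D p.2 * (1 - conn (p.1 + p.2)) := by ring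
    rw [this]
    exact h37 p
  -- Step 4: the insertion map along a shortest path, (3.8)–(3.9)
  obtain ⟨walk, hwalk⟩ := exists_walk_length_eq_l1Dist d x' y' hx hy
  set t : ℝ := (Real.tanh (β / 2))⁻¹ with ht
  have ht0 : 0 ≤ t := inv_nonneg.2 (Real.tanh_half_pos hβ).le
  have hins : ∀ n₁ : Current G,
      ∑' n₂ : Current G, b D n₂ * X n₁ n₂ ≤ t ^ l1Dist d x y * ∑' n₂ : Current G, b ∅ n₂ * X n₁ n₂ := by
    intro n₁
    have h := Current.tsum_ite_sources_le_of_walk hβ Λ (X n₁) (hX0 n₁) (hX1 n₁) (hXmono n₁) walk D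
    rw [hwalk, ← hD, Finset.inter_eq_left.2 hDΛ, symmDiff_self, Finset.bot_eq_empty] at h
    have hl : ∀ B n₂, b B n₂ * X n₁ n₂ = if n₂.sources ∩ Λ = B then n₂.weight β * X n₁ n₂ else 0 := by
      intro B n₂; simp only [hb]; split_ifs <;> simp
    simp only [hl]
    exact h
  have hM : ∑' p : Current G × Current G, a ∅ p.1 * (b D p.2 * X p.1 p.2) ≤
      t ^ l1Dist d x y * ∑' p : Current G × Current G, a ∅ p.1 * (b ∅ p.2 * X p.1 p.2) := by
    have hs3 : Summable fun p : Current G × Current G => a ∅ p.1 * (b D p.2 * X p.1 p.2) := by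
      have := hpair ∅ D (fun p => X p.1 p.2) (fun p => hXle _ _)
      simpa only [mul_assoc] using this
    have hs4 : Summable fun p : Current G × Current G => a ∅ p.1 * (b ∅ p.2 * X p.1 p.2) := by
      have := hpair ∅ ∅ (fun p => X p.1 p.2) (fun p => hXle _ _)
      simpa only [mul_assoc] using this
    rw [hs3.tsum_prod, hs4.tsum_prod, ← tsum_mul_left]
    refine Summable.tsum_le_tsum (fun n₁ => ?_) hs3.prod (hs4.prod.mul_left _)
    dsimp only
    rw [tsum_mul_left, tsum_mul_left, ← mul_assoc, mul_comm (t ^ _), mul_assoc]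
    exact mul_le_mul_of_nonneg_left (hins n₁) (ha0 ∅ n₁)
  -- Step 5: identification with the double-current law
  set J : Current G₀ × Current G → Current G × Current G := fun q => (Current.extend q.1, q.2) with hJ
  have hK : ∀ (g : Current G × Current G → ℝ),
      ∑' p : Current G × Current G, a ∅ p.1 * (b ∅ p.2 * g p) =
        ∑' q : Current G₀ × Current G, adsPairWeight d L β q * g (J q) :=
    fun g => (tsum_adsPairWeight_mul_eq d L β g).symm
  have hnorm : Z₀ ∅ * Z ∅ = adsPairNorm d L β := by
    rw [hprod]
    have := hK (fun _ => 1)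
    simp only [mul_one] at this
    rw [this, adsPairNorm]
  have hNpos : 0 < adsPairNorm d L β := by rw [← hnorm]; exact mul_pos hZ₀pos hZpos
  have hexitK : ∑' p : Current G × Current G, a ∅ p.1 * (b ∅ p.2 * X p.1 p.2) =
      adsPairNorm d L β * (adsDoubleCurrentLaw d L β).real (exitConn d L x) := by
    rw [hK (fun p => X p.1 p.2), adsDoubleCurrentLaw_real_apply d L hβ.le hNpos, ← tsum_mul_left]
    refine tsum_congr fun q => ?_
    simp only [hJ, hX, Current.traced_extend hle]
    field_simp
  -- conclusion
  rw [hplus, hfree, div_sub_div _ _ hZpos.ne' hZ₀pos.ne', ← inv_pow]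
  rw [show Z D * Z₀ ∅ - Z ∅ * Z₀ D = Z₀ ∅ * Z D - Z₀ D * Z ∅ by ring,
    show Z ∅ * Z₀ ∅ = adsPairNorm d L β by rw [← hnorm]; ring]
  rw [div_le_iff₀ hNpos]
  calc Z₀ ∅ * Z D - Z₀ D * Z ∅
      ≤ ∑' p : Current G × Current G, a ∅ p.1 * (b D p.2 * X p.1 p.2) := hN
    _ ≤ t ^ l1Dist d x y * ∑' p : Current G × Current G, a ∅ p.1 * (b ∅ p.2 * X p.1 p.2) := hM
    _ = t ^ l1Dist d x y * (adsDoubleCurrentLaw d L β).real (exitConn d L x) * adsPairNorm d L β := by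
        rw [hexitK]; ring

/-! ### Consequences: the random-current heart and `m*(β_c) = 0` from the deep fact alone -/

/-- **The random-current heart from ADS15 Thm. 3.1/2.3 alone**: with (3.10) proved,
`plusPair_eq_freePair_of_lroTildeSq` (`M̃_LRO(β) = 0 ⇒ ⟨σ_xσ_y⟩⁺_β = ⟨σ_xσ_y⟩⁰_β`) follows from the
single named fact `ads_exitProb_tendsto_zero_of_lroTildeSq`. [cite: AizenmanDuminilCopinSidoraviciusCMP2015, §3.2, eqs. (3.10)–(3.11)] -/
theorem plusPair_eq_freePair_of_lroTildeSq_of_exitProb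
    (hexit : ads_exitProb_tendsto_zero_of_lroTildeSq (d := d)) :
    plusPair_eq_freePair_of_lroTildeSq (d := d) :=
  plusPair_eq_freePair_of_lroTildeSq_of_currents' ads_gammaBound_holds hexit

/-- **`m*(β_c) = 0` in `d ≥ 3` from ADS15 Thm. 3.1/2.3 and the classical inputs**: the named fact
`spontaneousMagnetization_criticalBeta_eq_zero` follows from `ads_exitProb_tendsto_zero_of_lroTildeSq`
(infinite-volume random currents: Thm. 3.1 with Thms. 2.3, 2.5), the existence of the plus state
(`exists_plusMeasure`), the infrared bound (`infraredBound`) and `β_c > 0` (`criticalBeta_pos`);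
every other step of ADS15 §3 for the nearest-neighbour model is a theorem of the tree. [cite: AizenmanDuminilCopinSidoraviciusCMP2015, Thm. 1.2 with Cor. 1.5] -/
theorem spontaneousMagnetization_criticalBeta_eq_zero_of_exitProb
    (hexit : ads_exitProb_tendsto_zero_of_lroTildeSq (d := d))
    (hplus : ∀ β : ℝ, exists_plusMeasure d (β := β) 0)
    (hIR : ∀ (L : ℕ) [NeZero L], infraredBound (d := d) (L := L))
    (hβc : criticalBeta_pos (d := d)) :
    spontaneousMagnetization_criticalBeta_eq_zero (d := d) :=
  spontaneousMagnetization_criticalBeta_eq_zero_of_randomCurrents'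
    (plusPair_eq_freePair_of_lroTildeSq_of_exitProb hexit) hplus hIR hβc

end Literature.Probability.LatticeModels
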